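import Summits.QuantumFields.BalabanUV.Beta.D1BFx.NeedleTadpoleRow
import Summits.QuantumFields.BalabanUV.Beta.D1BFx.LocalTadpoleRowsDecay

/-!
# `BalabanUV.Beta.D1BFx.NeedleTadpoleRowDecay` — road «BF-x» for binder row D1, slot (K), END-ii END `RoadEndBFxWiredS.d1Drift_BFx_of_prop12S` (p292876),
# its LAST displayed rest input: **THE SLOT-4 GLUON TADPOLE ROW `h₈` (T₈) UNDER A DECAYING BOND-SEPARATION ENVELOPE OF THE TABLE `WQ`** («T₈ PREP» ∕
# «NT-8-DECAY») — NT-8 (`NeedleTadpoleRow`, finite bond-separation support `hsupp`) with `hsupp` REPLACED by the displayed socket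
# `hWQenv : BiLoc (WQ n κ u l u′) u u′ (CwQ n·e^{−(θQ∕n)‖u−u′‖∞}) (δQ n)` and ONE units line, so that the (A2) pin of `WQ` closes `h₈` BY INSTANTIATION

HONEST DEPENDENCY (cell records, verbatim): «continuum YM on T⁴ ⇐ BetaPertH ∧ nine spine estimates (0/9 proved); BetaPertH ⇐ (D1) ∧ (D4) ∧
CAP+tail; G-an2-4 gates asym, D1 and NE2/3/4.»  HONEST FRAMING (cell contract, verbatim): «discharging `BetaPertH` makes Bałaban's UV stability
UNCONDITIONAL — a real constructive-QFT result; it is NOT the continuum limit and NOT the Clay problem.»  THIS MODULE DISCHARGES NOTHING of the wall: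
it is [folklore] bookkeeping BY NAME over `LocalTadpoleRowsDecay.conv_and_abs_fullSum_tadpoleWord_of_decay` (leaf-04 g10: the generic tadpole word
under a decaying envelope, window kit `LatticeHLSProfiles.sum_pow_mul_exp_div_nrm_pow_free_scale_le` of leaf-04 g9), the n-FREE gluon-leg entry bound
`LocalTadpoleRows.abs_Ga_le_flatEntry` (leaf-04 g8), NT-8's two `rfl` dictionaries (`NeedleTadpoleRow.tadpoleTable_eq_tadpoleTableA`,
`tadpoleTableA_eq_baseKer`), the owner's `Assembly.sum_uniform_resSite` ∕ `ContactCount.abs_sum_mul_le_of_convex` (convex base-point average),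
`LatticeConstantZl.Zl_anti` ∕ `Zl_le_elem` and `NeedleDipDipLetters.exp_blockDecay_le_siteDamped`.  The slot-4 table `WQ`, the weights `ωgl`, `cQ₂`, the
envelope data `(CwQ, θQ, δQ)` and every constant are ARBITRARY parameters: nothing about Bałaban's operators is asserted; WHICH of the three readings
of the units line Bałaban's `WQ` satisfies, and its `(CwQ n, θQ, δQ n)`, is the (A2) readout (an2, PIN-MAP Q-PM-1∕2) — NOT here.  No `def`,
no `def … : Prop`, nothing cited, 0 sorry.  Root-level binders hW ∕ hR-sockets ∕ hSX-socket ∕ D1Tel ∕ D1Rep — 0 discharged; T₈ stays OPEN until the pin;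
(K) NOT closed; NOT D1, NOT `BetaPertH`, NOT continuum, NOT Clay.

ABSOLUTE RULE (cell charter, verbatim): «No internally-minted statement may enter as a cited fact. Every hypothesis is either kernel-proved in this
package or a verbatim quotation of a PUBLISHED theorem with page reference. The manuscript(s) under audit are NOT citable for their own disputed
steps — they are the thing under adjudication; programme-internal (2001/route/tribunal) claims are never citable.»

WHY (owner d1-p2-g12 WORD l.34243 (b): «T₈ PREP = the slot-4 gluon tadpole row `h₈` in END-agnostic tolerance form with the (A2) readout of `WQ`
DISPLAYED as a socket (`hWQenv : BiLoc (WQ n …) … (CwQ n·e^{−(θQ∕n)‖u−u′‖}) (δQ n)` + a units line `hkQ`), pattern = leaf-04-g10's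
`LocalTadpoleRowsDecay.hLoc_tad_of_decay_scaling` transposed to the needle fibre's slot-4 words, so that when an2 pins `WQ` the END-ii END's last rest
input closes by instantiation»; ruling ρ-g9-29 «T₈ REOPENED: `WQ` of record is block-structured» — i.e. NOT finitely supported in the bond separation at an
n-free radius, which is what NT-8's `h₈_of_local(_scaling)` needs).  The row (the END-ii END's binder `h₈`, ≡ `NeedleRowGlue.abs_gN_row_le_of_tables`' and
`NeedleGroupRow.abs_gN_row_le_of_prop12''`'s) is
`h₈ : ∀ n ≥ 2, |ωgl n · cQ₂ n · Σ_{b ∈ image resSite} n⁻⁴ · (n⁻⁸ · fullSum (w ↦ w_μ w_ν · tadpoleTable n a (WQ n) μ ν (b+w) b))| ≤ C₈`.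
Since `tadpoleTable n a W μ ν (b+w) b = baseKer (tadpoleTableA (Ga n a) W μ ν) b w` definitionally, g10's generic word applies VERBATIM at the gluon leg
with the n-FREE entry constant `E := cG0 4 + (woodburyDc 0 + ellD0 4 a) + ellD0 4 a`: the base-point word is `≤ T·S₀(θ)·n⁶`,
`T = ½·4·(4·E·Cw·Zl 4 δ)·Zl 4 δ`, `S₀(θ)·n⁶ = 2·2!·(2∕θ)²·(1 + 216·(3!·(4∕θ)³·(1+4∕θ)))·n⁶` (the window `Σ_w |w_μw_ν|·e^{−(θ∕n)‖w‖∞}`), the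
base-point average is convex, and the row is `|ωgl·cQ₂|·n⁻⁸·T·S₀(θ)·n⁶`.  THE n-POWER LEDGER (three readings of the units line, `C₈` explicit):
SITE-scale rate floor `δ₀ ≤ δQ n` ⟹ `Zl² = O(1)` ⟹ tolerance `n²` (`|ωgl n·cQ₂ n|·CwQ n ≤ k·n²`); BLOCK-scale floor `δ₀∕n ≤ δQ n` ⟹ `Zl² ≤ (1+2∕δ₀)⁸·n⁸` ⟹
tolerance `n⁻⁶` (`|ωgl n·cQ₂ n|·CwQ n·n⁶ ≤ k`, the slot-R count of `LocalTadpoleRowsDecay` §3 verbatim); block-METRIC envelope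
`CwQ n·e^{−θQ·dist(blk u, blk u′)}` ⟹ the same with the factor `e^{θQ}`.  (NT-8, finite support `ρ` + site floor: tolerance `n⁶`.)

CONTENT (all [folklore]; the letters written out, never named).
* §1 fixed `n`, any slot table `W : TableR`: **`conv_and_abs_fullSum_row₈_of_decay`** ((CONV) ∧ `|fullSum (w ↦ w_μw_ν·tadpoleTable n a W μ ν (b+w) b)| ≤ T·S₀(θ)·n⁶`
  at every base site), `conv_row₈_of_decay`, **`abs_row₈_le_of_decay`** (base-point averaged, any prefactor `c`:
  `|c · Σ_b n⁻⁴·(n⁻⁸·fullSum (…))| ≤ |c|·(n⁻⁸·(T·S₀(θ)·n⁶))`).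
* §2 along `n`, OUTPUT = `h₈` VERBATIM: **`h₈_of_decay`** (socket `hWQenv` + ONE displayed scalar inequality `hC₈`), **`h₈_of_decay_scaling`** (site floor,
  `|ωgl n·cQ₂ n|·CwQ n ≤ k·n²` ⊢ `C₈ := k·E·(8·(Zl 4 δ₀)²)·S₀(θQ)`), **`h₈_of_blockRate_scaling`** (block floor, `|ωgl n·cQ₂ n|·CwQ n·n⁶ ≤ k` ⊢
  `C₈ := k·E·(8·(1+2∕δ₀)⁸)·S₀(θQ)`), **`h₈_of_blockDecay_scaling`** (block-metric envelope ⊢ `C₈ := (k·e^{θQ})·E·(8·(1+2∕δ₀)⁸)·S₀(θQ)`).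
NOT HERE (honest): that Bałaban's `WQ` satisfies any of the envelopes, and the values `(CwQ n, θQ, δQ n)`, `cQ₂ n` — the (A2) readout ∕ an2's pins.
Unit `b2b-balaban-beta-d1-formalise-leaf-04` (gen 14), D1 formalisation swarm; `LEAVES-BFx.md` row (N) ∕ «T₈» (socket side).
-/

noncomputable section

namespace Summit.QuantumFields.BalabanUV.Beta.D1BFx.NeedleTadpoleRowDecay

open Finset Filter Topology
open scoped BigOperators
open Literature.MathematicalPhysics.QuantumFieldTheory.Balaban1983to89
open Literature.MathematicalPhysics.QuantumFieldTheory.Balaban1983to89.Beta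
open ExpKernelCalculus (Site MKer BiLoc Zl Zl_nonneg)
open LatticeConstantZl (Zl_anti Zl_le_elem)
open DyadicShell (Pt toReal supNorm)
open WindowIdentification (psum fullSum)
open DressedMomentNormalisation (resSite)
open LongitudinalWindow (ellD0)
open WoodburyCovariant (woodburyDc)
open VectorLegVolumeAdapter (woodburyDc_zero_nonneg)
open Summit.QuantumFields.BalabanUV.Beta.D1BFx.MomentTransferPeriodic (baseKer)
open Summit.QuantumFields.BalabanUV.Beta.D1BFx.GluonLeg (Ga)
open Summit.QuantumFields.BalabanUV.Beta.D1BFx.ReducedKernel (TableR)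
open Summit.QuantumFields.BalabanUV.Beta.D1BFx.DressedTablesLeg (tadpoleTableA)
open Summit.QuantumFields.BalabanUV.Beta.D1BFx.DressedTadpoleTable (tadpoleTable)
open Summit.QuantumFields.BalabanUV.Beta.D1BFx.ContactCount (abs_sum_mul_le_of_convex)
open Summit.QuantumFields.BalabanUV.Beta.D1BFx.Assembly (sum_uniform_resSite uniform_resSite_nonneg)
open Summit.QuantumFields.BalabanUV.Beta.D1BFx.NeedleTadpoleRow (tadpoleTable_eq_tadpoleTableA tadpoleTableA_eq_baseKer)
open Summit.QuantumFields.BalabanUV.Beta.D1BFx.LocalTadpoleRows (abs_Ga_le_flatEntry)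
open Summit.QuantumFields.BalabanUV.Beta.D1BFx.LocalTadpoleRowsDecay (conv_and_abs_fullSum_tadpoleWord_of_decay)
open Summit.QuantumFields.BalabanUV.Beta.D1BFx.OffDiagonalLegGrade (ellD0_nonneg)
open Summit.QuantumFields.BalabanUV.Beta.D1BFx.PointColumnSplit (cG0 cG0_nonneg)
open Summit.QuantumFields.BalabanUV.Beta.D1BFx.NeedleDipDipLetters (exp_blockDecay_le_siteDamped)
open B6QGQLower276 (blk)

/-! ## §1 Fixed block size: the slot-4-type tadpole row under a decaying bond-separation envelope -/

section Fixed

variable (n : ℕ) [NeZero n] (a : ℝ) {W : TableR} {Cw δ θ : ℝ}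

/-- [folklore] The n-free gluon-leg entry constant `E = cG0 4 + (woodburyDc 0 + ellD0 4 a) + ellD0 4 a` is non-negative (`a > 0`). -/
theorem flatEntry_nonneg (ha : 0 < a) : 0 ≤ cG0 4 + (woodburyDc 0 + ellD0 4 a) + ellD0 4 a := by
  have h1 := cG0_nonneg 4
  have h2 := woodburyDc_zero_nonneg
  have h3 := ellD0_nonneg (d := 4) ha
  positivity

/-- [folklore] **THE ROW INTEGRAND AT A BASE SITE UNDER THE DECAYING ENVELOPE — (CONV) AND THE WEIGHTED FULL SUM.**  For any slot table `W` bi-localised at its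
two bonds at rate `δ > 0` with a constant decaying in the bond separation at the block scale, `BiLoc (W κ u l u′) u u′ (Cw·e^{−(θ∕n)‖u−u′‖∞}) δ`
(`Cw ≥ 0`, `θ > 0`): the punctured partial sums of `w ↦ w_μw_ν·tadpoleTable n a W μ ν (b+w) b` converge and
`|fullSum| ≤ (½·4·(4·E·Cw·Zl 4 δ)·Zl 4 δ)·S₀(θ)·n⁶` at EVERY base site `b` — g10's generic word at the gluon leg `Ga n a` with the n-FREE entry bound
`E` (`LocalTadpoleRows.abs_Ga_le_flatEntry`), prefactor `1`. -/
theorem conv_and_abs_fullSum_row₈_of_decay (ha : 0 < a) (hCw : 0 ≤ Cw) (hδ : 0 < δ) (hθ : 0 < θ)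
    (hW : ∀ κ u l u', BiLoc (W κ u l u') u u' (Cw * Real.exp (-(θ / n) * supNorm (u - u'))) δ) (μ ν : Fin 4) (b : Pt) :
    (∃ B, Tendsto (psum (fun w : Pt => toReal w μ * toReal w ν * tadpoleTable n a W μ ν (b + w) b)) atTop (𝓝 B)) ∧
      |fullSum (fun w : Pt => toReal w μ * toReal w ν * tadpoleTable n a W μ ν (b + w) b)| ≤
        ((1 / 2 : ℝ) * ((4 : ℝ) * ((4 : ℝ) * ((cG0 4 + (woodburyDc 0 + ellD0 4 a) + ellD0 4 a) * Cw) * Zl 4 δ) * Zl 4 δ)) *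
          (2 * (2 : ℕ).factorial * (2 / θ) ^ 2 * (1 + 2 * (4 : ℕ) * 3 ^ (4 - 1) * ((4 - 1 - 0).factorial * (4 / θ) ^ (4 - 1 - 0) * (1 + 4 / θ)))
            * (n : ℝ) ^ (4 - 0 + 2)) := by
  have hn : 1 ≤ n := NeZero.one_le
  have h := conv_and_abs_fullSum_tadpoleWord_of_decay (A := Ga n a) (W := W) hn (flatEntry_nonneg a ha) hCw hδ hθ
    (fun x y κ l => abs_Ga_le_flatEntry n ha x y κ l) hW 1 μ ν b
  have e : (fun w : Pt => (1 : ℝ) * (toReal w μ * toReal w ν * baseKer (tadpoleTableA (Ga n a) W μ ν) b w)) =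
      fun w : Pt => toReal w μ * toReal w ν * tadpoleTable n a W μ ν (b + w) b := by
    funext w
    rw [one_mul, tadpoleTable_eq_tadpoleTableA n a W, tadpoleTableA_eq_baseKer]
  rw [e] at h
  simpa only [Fintype.card_fin, Nat.cast_ofNat, abs_one, one_mul] using h

/-- [folklore] **(CONV) FROM THE ENVELOPE ALONE** for the row integrand at every base site. -/
theorem conv_row₈_of_decay (ha : 0 < a) (hCw : 0 ≤ Cw) (hδ : 0 < δ) (hθ : 0 < θ)
    (hW : ∀ κ u l u', BiLoc (W κ u l u') u u' (Cw * Real.exp (-(θ / n) * supNorm (u - u'))) δ) (μ ν : Fin 4) (b : Pt) :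
    ∃ B, Tendsto (psum (fun w : Pt => toReal w μ * toReal w ν * tadpoleTable n a W μ ν (b + w) b)) atTop (𝓝 B) :=
  (conv_and_abs_fullSum_row₈_of_decay n a ha hCw hδ hθ hW μ ν b).1

/-- [folklore] **THE SLOT-4-TYPE TADPOLE ROW AT FIXED `n`, BASE-POINT AVERAGED, UNDER THE DECAYING ENVELOPE** (uniform weights `n⁻⁴` on the residue sites
are convex: `Assembly.sum_uniform_resSite`; NT-8's `abs_row₈_le` with `hsupp ↦` the envelope): for any scalar prefactor `c`,
`|c · Σ_{b ∈ image resSite} n⁻⁴·(n⁻⁸·fullSum (w ↦ w_μw_ν·tadpoleTable n a W μ ν (b+w) b))| ≤ |c|·(n⁻⁸·((½·4·(4·E·Cw·Zl 4 δ)·Zl 4 δ)·S₀(θ)·n⁶))`. -/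
theorem abs_row₈_le_of_decay (ha : 0 < a) (hCw : 0 ≤ Cw) (hδ : 0 < δ) (hθ : 0 < θ)
    (hW : ∀ κ u l u', BiLoc (W κ u l u') u u' (Cw * Real.exp (-(θ / n) * supNorm (u - u'))) δ) (c : ℝ) (μ ν : Fin 4) :
    |c * ∑ b ∈ (univ : Finset (Fin 4 → Fin n)).image resSite, ((n : ℝ) ^ 4)⁻¹ * (((n : ℝ) ^ 8)⁻¹ *
        fullSum (fun w : Pt => toReal w μ * toReal w ν * tadpoleTable n a W μ ν (b + w) b))| ≤
      |c| * (((n : ℝ) ^ 8)⁻¹ *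
        (((1 / 2 : ℝ) * ((4 : ℝ) * ((4 : ℝ) * ((cG0 4 + (woodburyDc 0 + ellD0 4 a) + ellD0 4 a) * Cw) * Zl 4 δ) * Zl 4 δ)) *
          (2 * (2 : ℕ).factorial * (2 / θ) ^ 2 * (1 + 2 * (4 : ℕ) * 3 ^ (4 - 1) * ((4 - 1 - 0).factorial * (4 / θ) ^ (4 - 1 - 0) * (1 + 4 / θ)))
            * (n : ℝ) ^ (4 - 0 + 2)))) := by
  have hword := fun b : Pt => (conv_and_abs_fullSum_row₈_of_decay n a ha hCw hδ hθ hW μ ν b).2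
  have hT : 0 ≤ ((1 / 2 : ℝ) * ((4 : ℝ) * ((4 : ℝ) * ((cG0 4 + (woodburyDc 0 + ellD0 4 a) + ellD0 4 a) * Cw) * Zl 4 δ) * Zl 4 δ)) *
      (2 * (2 : ℕ).factorial * (2 / θ) ^ 2 * (1 + 2 * (4 : ℕ) * 3 ^ (4 - 1) * ((4 - 1 - 0).factorial * (4 / θ) ^ (4 - 1 - 0) * (1 + 4 / θ)))
        * (n : ℝ) ^ (4 - 0 + 2)) :=
    (abs_nonneg _).trans (hword 0)
  rw [abs_mul]
  refine mul_le_mul_of_nonneg_left ?_ (abs_nonneg c)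
  refine abs_sum_mul_le_of_convex _ (fun b hb => uniform_resSite_nonneg n b hb) (sum_uniform_resSite (NeZero.ne n)) fun b _ => ?_
  rw [abs_mul, abs_of_nonneg (by positivity : (0 : ℝ) ≤ ((n : ℝ) ^ 8)⁻¹)]
  exact mul_le_mul_of_nonneg_left (hword b) (by positivity)

end Fixed

/-! ## §2 Along the block sizes, in the glue's ∕ the END's currency: `h₈` from the socket + ONE displayed scalar inequality -/

section Glue

variable {a : ℝ} {WQ : ℕ → TableR} {CwQ δQ ωgl cQ₂ : ℕ → ℝ} {θQ C₈ : ℝ}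

/-- [folklore] **«T₈ PREP»: THE SLOT-4 TADPOLE ROW `h₈` OF THE NEEDLE GROUP FROM THE DECAYING-ENVELOPE SOCKET OF `WQ`** — displayed, for every block size:
the socket `hWQenv` (bi-localisation at the two bonds at rate `δQ n > 0` with the constant `CwQ n·e^{−(θQ∕n)‖u−u′‖∞}`, `CwQ n ≥ 0`, `θQ > 0`) and ONE scalar
inequality `hC₈` on the loop weight, the slot weight, the envelope and the n-free leg entry constant `E` (slot (K)'s units; ruled nowhere here).  Output =
the END-ii END's binder `h₈` (`RoadEndBFxWiredS.d1Drift_BFx_of_prop12S`; ≡ `NeedleRowGlue.abs_gN_row_le_of_tables`' `h₈`) VERBATIM. -/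
theorem h₈_of_decay (ha : 0 < a) (hθ : 0 < θQ) (hδQ : ∀ n, 0 < δQ n) (hCwQ : ∀ n, 0 ≤ CwQ n)
    (hWQenv : ∀ n κ u l u', BiLoc (WQ n κ u l u') u u' (CwQ n * Real.exp (-(θQ / n) * supNorm (u - u'))) (δQ n))
    (hC₈ : ∀ n : ℕ, 2 ≤ n → |ωgl n * cQ₂ n| * (((n : ℝ) ^ 8)⁻¹ *
        (((1 / 2 : ℝ) * ((4 : ℝ) * ((4 : ℝ) * ((cG0 4 + (woodburyDc 0 + ellD0 4 a) + ellD0 4 a) * CwQ n) * Zl 4 (δQ n)) * Zl 4 (δQ n))) *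
          (2 * (2 : ℕ).factorial * (2 / θQ) ^ 2 * (1 + 2 * (4 : ℕ) * 3 ^ (4 - 1) * ((4 - 1 - 0).factorial * (4 / θQ) ^ (4 - 1 - 0) * (1 + 4 / θQ)))
            * (n : ℝ) ^ (4 - 0 + 2)))) ≤ C₈)
    (μ ν : Fin 4) :
    ∀ n : ℕ, 2 ≤ n → ∀ [NeZero n], |ωgl n * cQ₂ n * ∑ b ∈ (univ : Finset (Fin 4 → Fin n)).image resSite, ((n : ℝ) ^ 4)⁻¹ * (((n : ℝ) ^ 8)⁻¹ *
      fullSum (fun w : Pt => toReal w μ * toReal w ν * tadpoleTable n a (WQ n) μ ν (b + w) b))| ≤ C₈ :=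
  fun n hn _ => (abs_row₈_le_of_decay n a ha (hCwQ n) (hδQ n) hθ (hWQenv n) (ωgl n * cQ₂ n) μ ν).trans (hC₈ n hn)

/-- [folklore] **«T₈ PREP» — READING 1 OF THE UNITS LINE (SITE-SCALE RATE FLOOR), TOLERANCE `n²`**: under `0 < δ₀ ≤ δQ n` (`Zl 4 (δQ n) ≤ Zl 4 δ₀`,
`LatticeConstantZl.Zl_anti`) and the scaling letter `|ωgl n·cQ₂ n|·CwQ n ≤ k·n²` (`n ≥ 2`), the row `h₈` holds with
`C₈ := k·E·(8·(Zl 4 δ₀)²)·S₀(θQ)`.  EXPONENT LEDGER: `n⁻⁸ · Zl² · window = n⁻⁸ · n⁰ · n⁶ = n⁻²` ⟹ the units line may grow like `n²`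
(`|ωgl n·cQ₂ n|·CwQ n ≤ k·n²`). -/
theorem h₈_of_decay_scaling (ha : 0 < a) (hθ : 0 < θQ) (hδQ : ∀ n, 0 < δQ n) {δ₀ k : ℝ} (hδ₀ : 0 < δ₀) (hδge : ∀ n, δ₀ ≤ δQ n)
    (hCwQ : ∀ n, 0 ≤ CwQ n)
    (hWQenv : ∀ n κ u l u', BiLoc (WQ n κ u l u') u u' (CwQ n * Real.exp (-(θQ / n) * supNorm (u - u'))) (δQ n))
    (hk : ∀ n : ℕ, 2 ≤ n → |ωgl n * cQ₂ n| * CwQ n ≤ k * (n : ℝ) ^ 2) (μ ν : Fin 4) :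
    ∀ n : ℕ, 2 ≤ n → ∀ [NeZero n], |ωgl n * cQ₂ n * ∑ b ∈ (univ : Finset (Fin 4 → Fin n)).image resSite, ((n : ℝ) ^ 4)⁻¹ * (((n : ℝ) ^ 8)⁻¹ *
      fullSum (fun w : Pt => toReal w μ * toReal w ν * tadpoleTable n a (WQ n) μ ν (b + w) b))| ≤
        k * (cG0 4 + (woodburyDc 0 + ellD0 4 a) + ellD0 4 a) * (8 * (Zl 4 δ₀) ^ 2) *
          (2 * (2 : ℕ).factorial * (2 / θQ) ^ 2 * (1 + 2 * (4 : ℕ) * 3 ^ (4 - 1) * ((4 - 1 - 0).factorial * (4 / θQ) ^ (4 - 1 - 0) * (1 + 4 / θQ)))) := by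
  refine h₈_of_decay ha hθ hδQ hCwQ hWQenv (fun n hn => ?_) μ ν
  have hn1 : 1 ≤ n := le_trans one_le_two hn
  have hn0 : (0 : ℝ) < n := by exact_mod_cast (lt_of_lt_of_le zero_lt_one hn1)
  have hnz : (n : ℝ) ≠ 0 := hn0.ne'
  set E : ℝ := cG0 4 + (woodburyDc 0 + ellD0 4 a) + ellD0 4 a with hEdef
  set S : ℝ := 2 * (2 : ℕ).factorial * (2 / θQ) ^ 2 * (1 + 2 * (4 : ℕ) * 3 ^ (4 - 1) * ((4 - 1 - 0).factorial * (4 / θQ) ^ (4 - 1 - 0) * (1 + 4 / θQ)))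
    with hSdef
  have hE0 : 0 ≤ E := flatEntry_nonneg a ha
  have hS0 : 0 ≤ S := by positivity
  have hCwn := hCwQ n
  have hkn := hk n hn
  have hk0 : 0 ≤ k := by
    have h : 0 ≤ k * (n : ℝ) ^ 2 := le_trans (by positivity) hkn
    exact nonneg_of_mul_nonneg_left h (by positivity)
  -- the two Zl's at the site scale
  have hZ0 : 0 ≤ Zl 4 (δQ n) := Zl_nonneg (hδQ n)
  have hZ1 : Zl 4 (δQ n) ≤ Zl 4 δ₀ := Zl_anti hδ₀ (hδge n)
  have hZsq : Zl 4 (δQ n) * Zl 4 (δQ n) ≤ Zl 4 δ₀ * Zl 4 δ₀ := mul_le_mul hZ1 hZ1 hZ0 (hZ0.trans hZ1)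
  have e : |ωgl n * cQ₂ n| * (((n : ℝ) ^ 8)⁻¹ * (((1 / 2 : ℝ) * ((4 : ℝ) * ((4 : ℝ) * (E * CwQ n) * Zl 4 (δQ n)) * Zl 4 (δQ n))) *
        (S * (n : ℝ) ^ (4 - 0 + 2))))
      = (|ωgl n * cQ₂ n| * CwQ n) * ((n : ℝ) ^ 6 * ((n : ℝ) ^ 8)⁻¹) * ((8 * E * S) * (Zl 4 (δQ n) * Zl 4 (δQ n))) := by
    ring
  rw [e]
  have hpow : (n : ℝ) ^ 2 * ((n : ℝ) ^ 6 * ((n : ℝ) ^ 8)⁻¹) = 1 := by field_simp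
  calc (|ωgl n * cQ₂ n| * CwQ n) * ((n : ℝ) ^ 6 * ((n : ℝ) ^ 8)⁻¹) * ((8 * E * S) * (Zl 4 (δQ n) * Zl 4 (δQ n)))
      ≤ (k * (n : ℝ) ^ 2) * ((n : ℝ) ^ 6 * ((n : ℝ) ^ 8)⁻¹) * ((8 * E * S) * (Zl 4 δ₀ * Zl 4 δ₀)) :=
        mul_le_mul (mul_le_mul_of_nonneg_right hkn (by positivity)) (mul_le_mul_of_nonneg_left hZsq (by positivity)) (by positivity)
          (by positivity)
    _ = k * ((n : ℝ) ^ 2 * ((n : ℝ) ^ 6 * ((n : ℝ) ^ 8)⁻¹)) * ((8 * E * S) * (Zl 4 δ₀ * Zl 4 δ₀)) := by ring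
    _ = k * E * (8 * (Zl 4 δ₀) ^ 2) * S := by rw [hpow]; ring

/-- [folklore] **«T₈ PREP» — READING 2 OF THE UNITS LINE (BLOCK-SCALE RATE FLOOR), TOLERANCE `n⁻⁶`**: under `δ₀∕n ≤ δQ n` (`δ₀ > 0`, `δQ n > 0`;
`Zl 4 (δQ n) ≤ (1 + 2∕δ₀)⁴·n⁴` by `Zl_anti` ∕ `Zl_le_elem`) and the scaling letter `|ωgl n·cQ₂ n|·CwQ n·n⁶ ≤ k` (`n ≥ 2`), the row `h₈` holds with
`C₈ := k·E·(8·(1+2∕δ₀)⁸)·S₀(θQ)`.  EXPONENT LEDGER: `n⁻⁸ · Zl² · window = n⁻⁸ · n⁸ · n⁶ = n⁶` ⟹ the units line must decay like `n⁻⁶`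
(`|ωgl n·cQ₂ n|·CwQ n·n⁶ ≤ k`; the slot-R count of `LocalTadpoleRowsDecay.hLoc_tad_of_decay_scaling` verbatim). -/
theorem h₈_of_blockRate_scaling (ha : 0 < a) (hθ : 0 < θQ) (hδQ : ∀ n, 0 < δQ n) {δ₀ k : ℝ} (hδ₀ : 0 < δ₀)
    (hδge : ∀ n : ℕ, δ₀ / n ≤ δQ n) (hCwQ : ∀ n, 0 ≤ CwQ n)
    (hWQenv : ∀ n κ u l u', BiLoc (WQ n κ u l u') u u' (CwQ n * Real.exp (-(θQ / n) * supNorm (u - u'))) (δQ n))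
    (hk : ∀ n : ℕ, 2 ≤ n → |ωgl n * cQ₂ n| * CwQ n * (n : ℝ) ^ 6 ≤ k) (μ ν : Fin 4) :
    ∀ n : ℕ, 2 ≤ n → ∀ [NeZero n], |ωgl n * cQ₂ n * ∑ b ∈ (univ : Finset (Fin 4 → Fin n)).image resSite, ((n : ℝ) ^ 4)⁻¹ * (((n : ℝ) ^ 8)⁻¹ *
      fullSum (fun w : Pt => toReal w μ * toReal w ν * tadpoleTable n a (WQ n) μ ν (b + w) b))| ≤
        k * (cG0 4 + (woodburyDc 0 + ellD0 4 a) + ellD0 4 a) * (8 * (1 + 2 / δ₀) ^ 8) *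
          (2 * (2 : ℕ).factorial * (2 / θQ) ^ 2 * (1 + 2 * (4 : ℕ) * 3 ^ (4 - 1) * ((4 - 1 - 0).factorial * (4 / θQ) ^ (4 - 1 - 0) * (1 + 4 / θQ)))) := by
  refine h₈_of_decay ha hθ hδQ hCwQ hWQenv (fun n hn => ?_) μ ν
  have hn1 : 1 ≤ n := le_trans one_le_two hn
  have hn0 : (0 : ℝ) < n := by exact_mod_cast (lt_of_lt_of_le zero_lt_one hn1)
  have hnz : (n : ℝ) ≠ 0 := hn0.ne'
  set E : ℝ := cG0 4 + (woodburyDc 0 + ellD0 4 a) + ellD0 4 a with hEdef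
  set S : ℝ := 2 * (2 : ℕ).factorial * (2 / θQ) ^ 2 * (1 + 2 * (4 : ℕ) * 3 ^ (4 - 1) * ((4 - 1 - 0).factorial * (4 / θQ) ^ (4 - 1 - 0) * (1 + 4 / θQ)))
    with hSdef
  have hE0 : 0 ≤ E := flatEntry_nonneg a ha
  have hS0 : 0 ≤ S := by positivity
  have hCwn := hCwQ n
  have hkn := hk n hn
  have hk0 : 0 ≤ k := le_trans (by positivity) hkn
  -- the two Zl's at the block scale
  have hZ0 : 0 ≤ Zl 4 (δQ n) := Zl_nonneg (hδQ n)
  have hZ1 : Zl 4 (δQ n) ≤ (1 + 2 / δ₀) ^ 4 * (n : ℝ) ^ 4 := by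
    have h1 : Zl 4 (δQ n) ≤ Zl 4 (δ₀ / n) := Zl_anti (div_pos hδ₀ hn0) (hδge n)
    have h2 : Zl 4 (δ₀ / n) ≤ (1 + 2 / (δ₀ / n)) ^ 4 := Zl_le_elem (div_pos hδ₀ hn0) 4
    have h3 : 1 + 2 / (δ₀ / (n : ℝ)) ≤ (1 + 2 / δ₀) * n := by
      rw [div_div_eq_mul_div, add_mul, one_mul]
      have e : (2 : ℝ) * n / δ₀ = 2 / δ₀ * n := by ring
      rw [e]
      have hnR : (1 : ℝ) ≤ n := by exact_mod_cast hn1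
      linarith
    have h4 : (0 : ℝ) ≤ 1 + 2 / (δ₀ / n) := by positivity
    calc Zl 4 (δQ n) ≤ (1 + 2 / (δ₀ / n)) ^ 4 := h1.trans h2
      _ ≤ ((1 + 2 / δ₀) * n) ^ 4 := pow_le_pow_left₀ h4 h3 4
      _ = (1 + 2 / δ₀) ^ 4 * (n : ℝ) ^ 4 := by ring
  have hZsq : Zl 4 (δQ n) * Zl 4 (δQ n) ≤ ((1 + 2 / δ₀) ^ 4 * (n : ℝ) ^ 4) * ((1 + 2 / δ₀) ^ 4 * (n : ℝ) ^ 4) :=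
    mul_le_mul hZ1 hZ1 hZ0 (by positivity)
  have e : |ωgl n * cQ₂ n| * (((n : ℝ) ^ 8)⁻¹ * (((1 / 2 : ℝ) * ((4 : ℝ) * ((4 : ℝ) * (E * CwQ n) * Zl 4 (δQ n)) * Zl 4 (δQ n))) *
        (S * (n : ℝ) ^ (4 - 0 + 2))))
      = (|ωgl n * cQ₂ n| * CwQ n * (n : ℝ) ^ 6) * ((8 * E * S) * ((Zl 4 (δQ n) * Zl 4 (δQ n)) * ((n : ℝ) ^ 8)⁻¹)) := by
    ring
  rw [e]
  calc (|ωgl n * cQ₂ n| * CwQ n * (n : ℝ) ^ 6) * ((8 * E * S) * ((Zl 4 (δQ n) * Zl 4 (δQ n)) * ((n : ℝ) ^ 8)⁻¹))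
      ≤ k * ((8 * E * S) * ((((1 + 2 / δ₀) ^ 4 * (n : ℝ) ^ 4) * ((1 + 2 / δ₀) ^ 4 * (n : ℝ) ^ 4)) * ((n : ℝ) ^ 8)⁻¹)) :=
        mul_le_mul hkn (mul_le_mul_of_nonneg_left (mul_le_mul_of_nonneg_right hZsq (by positivity)) (by positivity)) (by positivity) hk0
    _ = k * E * (8 * (1 + 2 / δ₀) ^ 8) * S := by field_simp

/-- [folklore] **«T₈ PREP» — READING 3: THE ENVELOPE IN THE BLOCK METRIC** («`WQ` of record is block-structured», ρ-g9-29; the currency of the projector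
letters `e^{−θ·dist(blk ·, blk ·)}`): if `BiLoc (WQ n κ u l u′) u u′ (CwQ n·e^{−θQ·dist(blk u, blk u′)}) (δQ n)` with `θQ > 0`, `δQ n > 0`, `δ₀∕n ≤ δQ n`,
`CwQ n ≥ 0`, and the units line `|ωgl n·cQ₂ n|·CwQ n·n⁶ ≤ k` holds for `n ≥ 2`, then `h₈` holds with `C₈ := (k·e^{θQ})·E·(8·(1+2∕δ₀)⁸)·S₀(θQ)` (block
decay ⟹ site damping at rate `θQ∕n` with the factor `e^{θQ}`, `NeedleDipDipLetters.exp_blockDecay_le_siteDamped`; then reading 2).  EXPONENT LEDGER: as reading 2,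
`n⁻⁸ · Zl² · window = n⁻⁸ · n⁸ · n⁶ = n⁶` ⟹ `|ωgl n·cQ₂ n|·CwQ n·n⁶ ≤ k`, constant `× e^{θQ}`. -/
theorem h₈_of_blockDecay_scaling (ha : 0 < a) (hθ : 0 < θQ) (hδQ : ∀ n, 0 < δQ n) {δ₀ k : ℝ} (hδ₀ : 0 < δ₀)
    (hδge : ∀ n : ℕ, δ₀ / n ≤ δQ n) (hCwQ : ∀ n, 0 ≤ CwQ n)
    (hWQenv : ∀ n κ u l u', BiLoc (WQ n κ u l u') u u' (CwQ n * Real.exp (-(θQ * dist (blk (n - 1) u) (blk (n - 1) u')))) (δQ n))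
    (hk : ∀ n : ℕ, 2 ≤ n → |ωgl n * cQ₂ n| * CwQ n * (n : ℝ) ^ 6 ≤ k) (μ ν : Fin 4) :
    ∀ n : ℕ, 2 ≤ n → ∀ [NeZero n], |ωgl n * cQ₂ n * ∑ b ∈ (univ : Finset (Fin 4 → Fin n)).image resSite, ((n : ℝ) ^ 4)⁻¹ * (((n : ℝ) ^ 8)⁻¹ *
      fullSum (fun w : Pt => toReal w μ * toReal w ν * tadpoleTable n a (WQ n) μ ν (b + w) b))| ≤
        (k * Real.exp θQ) * (cG0 4 + (woodburyDc 0 + ellD0 4 a) + ellD0 4 a) * (8 * (1 + 2 / δ₀) ^ 8) *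
          (2 * (2 : ℕ).factorial * (2 / θQ) ^ 2 * (1 + 2 * (4 : ℕ) * 3 ^ (4 - 1) * ((4 - 1 - 0).factorial * (4 / θQ) ^ (4 - 1 - 0) * (1 + 4 / θQ)))) := by
  -- block decay ⟹ site damping, uniformly in n (at n = 0 the site rate is 0 and the bound is trivial)
  have henv : ∀ (n : ℕ) (u u' : Site 4), Real.exp (-(θQ * dist (blk (n - 1) u) (blk (n - 1) u')))
      ≤ Real.exp θQ * Real.exp (-(θQ / n) * supNorm (u - u')) := by
    intro n u u'
    rcases Nat.eq_zero_or_pos n with hn | hn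
    · subst hn
      have e : Real.exp (-(θQ / ((0 : ℕ) : ℝ)) * supNorm (u - u')) = 1 := by simp
      rw [e, mul_one]
      exact (Real.exp_le_one_iff.mpr (neg_nonpos.mpr (mul_nonneg hθ.le dist_nonneg))).trans (Real.one_le_exp hθ.le)
    · haveI : NeZero n := ⟨hn.ne'⟩
      have h := exp_blockDecay_le_siteDamped n hθ.le u u'
      rwa [← neg_sub u u', PoissonInterior.supNorm_neg] at h
  have hW' : ∀ n κ u l u', BiLoc (WQ n κ u l u') u u' ((CwQ n * Real.exp θQ) * Real.exp (-(θQ / n) * supNorm (u - u'))) (δQ n) := by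
    intro n κ u l u' x' y a' b'
    refine (hWQenv n κ u l u' x' y a' b').trans (mul_le_mul_of_nonneg_right ?_ (Real.exp_pos _).le)
    rw [mul_assoc]
    exact mul_le_mul_of_nonneg_left (henv n u u') (hCwQ n)
  have hCw' : ∀ n, 0 ≤ CwQ n * Real.exp θQ := fun n => mul_nonneg (hCwQ n) (Real.exp_pos θQ).le
  have hk' : ∀ n : ℕ, 2 ≤ n → |ωgl n * cQ₂ n| * (CwQ n * Real.exp θQ) * (n : ℝ) ^ 6 ≤ k * Real.exp θQ := by
    intro n hn
    have h := mul_le_mul_of_nonneg_right (hk n hn) (Real.exp_pos θQ).le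
    refine le_trans (le_of_eq ?_) h
    ring
  exact h₈_of_blockRate_scaling ha hθ hδQ hδ₀ hδge hCw' hW' hk' μ ν

end Glue

end Summit.QuantumFields.BalabanUV.Beta.D1BFx.NeedleTadpoleRowDecay

end
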